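import Summits.NavierStokesRegularity.NavierStokesRegularity.Theses.SubcubicESS
import Summits.NavierStokesRegularity.NavierStokesRegularity.Theorems.SubcubicESSVelocityRescale

/-!
# Route SubcubicESS — `UniformESSClosure` (item stmt-NavierStokesRegularity-10676)

The support item of route `SubcubicESS`:

  (∃ F, uniform velocity-only ESS bound in Tao's class with size function `F`) →
    the `L³` continuation criterion
    (`Literature.Analysis.FluidPDE.hasSmoothExtensionPast_of_eLpNorm_three_bounded`, written out).

In words: suppose there is *some* function `F : ℝ → ℝ` such that every classical solution of the
unforced Navier–Stokes system with `ν = 1` on `[0, T] × ℝ³` all of whose spatial derivatives are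
in `L^∞_t L²_x` (Tao's class) and with `‖u(t)‖_{L³} ≤ A` on `[0, T]`, `A ≥ 2`, obeys
`|u(t, x)| ≤ F(A) t^{-1/2}` for `0 < t ≤ T`. Then every classical solution with viscosity `ν > 0`
on `ℝ³ × [0, T)`, Leray–Hopf from its rapidly decaying datum, with `sup_{0 ≤ t < T} ‖u(t)‖₃ < ∞`,
extends as a classical solution past `T`.

## Proof

Verbatim the marching argument of
`Literature.Analysis.FluidPDE.hasSmoothExtensionPast_of_eLpNorm_three_bounded_of_tao2021'`
(`Literature/Analysis/FluidPDE/NSCriticalClosureTao2021.lean`, from Tao 2021 Thm. 1.2), with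
Tao's triple exponential `exp exp exp(A^C)` replaced by the abstract size `F(A)` (only the
velocity clause of Thm. 1.2 is read there), the local `H¹` theory
(`tao2011_smooth_local_existence_holds`, Tao 2013 Thm. 5.4) and weak–strong uniqueness
(`serrin_weak_strong_uniqueness_holds`) being theorems of the tree:

1. *Viscosity* (`subcubicESS_norm_le_of_velocity_bound`, file `SubcubicESSVelocityRescale.lean`).
   For a classical solution with viscosity `ν` on `[0, S]` with all `‖∇ⁿu(t)‖_{L²}` bounded and
   `‖u(t)‖₃ ≤ N`, the rescaled pair `w(s, x) = ν⁻¹u(s/ν, x)`, `q = ν⁻²p(s/ν, x)`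
   (`IsClassicalNSSolutionOn.viscosityRescale_zero`) is in Tao's class on `[0, νS]` with
   `‖w(s)‖₃ ≤ ν⁻¹N ≤ A := max(2, ν⁻¹N)`, so `|u(t, x)| = ν|w(νt, x)| ≤ ν F(A) (νt)^{-1/2}`; the
   constant does not depend on `S`.
2. *First patch, constants.* Tao's local solution from `u(0)` identifies `u` on `[0, T₁]`
   (weak–strong uniqueness), whence Sobolev bounds there; fix `E = max(F(A), 1)`,
   `M = max(1, ν E (νT₁/4)^{-1/2})`, an energy-good `t⋆ ∈ (T₁/2, T₁)`, `g₀ = ∫ |∇u(t⋆)|²`,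
   `κ = M²/(2ν)`, `A' = 2E₀ + g₀ e^{κT}`, `τ = cν³/(A' + 1)²`.
3. *Invariant* `I(S)`: `u ∈ L^∞([0, S]; Hⁿ)` for all `n` and `∫ |∇u(t)|² ≤ g₀ e^{κ(t - t⋆)}` on
   `[t⋆, S]`.
4. *Step.* Given `I(S)`, `S < T`: restart at a good `t' ∈ (S - τ/4, S]`, `‖u(t')‖²_{H¹} ≤ A' + 1`;
   Tao's local solution `v` on `[0, τ]` equals `u(· + t')` on `[0, min(τ, T - t'))`; `t' + τ > T`
   would extend `u` past `T`, so `t' + τ ≤ T`; the Sobolev bounds of `v` extend those of `u` to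
   `[0, t' + τ/2]`, Step 1 there gives `|u| ≤ M` on `[T₁/4, t' + τ/2]`, and the enstrophy
   inequality under this bound (`lintegral_frobeniusNormSq_fderiv_le_mul_exp`) propagates the
   invariant to `I(S + τ/4)`.
5. `I(t⋆ + kτ/4)` with `t⋆ + kτ/4 < T` for all `k` — absurd.

## References

* T. Tao, *Quantitative bounds for critically bounded solutions to the Navier–Stokes equations*,
  Proc. Sympos. Pure Math. 104 (2021) = arXiv:1908.04958, Thm. 1.1/1.2. [Tao2021QuantitativeNS]
* L. Escauriaza, G. Seregin, V. Šverák, Russ. Math. Surveys 58:2 (2003), Thm. 1.3.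
* G. Seregin, Comm. Math. Phys. 312 (2012), 833–845, Thm. 1.1.
* T. Tao, Anal. PDE 6 (2013) = arXiv:1108.1165, Thm. 5.4, footnote 3.
-/

noncomputable section

open Literature.Analysis.FluidPDE MeasureTheory Set Function Filter Topology
open scoped ENNReal NNReal

namespace Summit.NavierStokesRegularity.NavierStokesRegularity.Theorems

/-! ### The marching argument -/

/-- **Item stmt-NavierStokesRegularity-10676 (`UniformESSClosure`) of route `SubcubicESS`.**
A uniform velocity-only Escauriaza–Seregin–Šverák bound in Tao's class with *any* size function
`F` (`∃ F, ∀ T A u p`, Tao-class on `[0, T]`, `‖u(t)‖₃ ≤ A`, `A ≥ 2` ⇒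
`|u(t, x)| ≤ F(A) t^{-1/2}`) implies the `L³` continuation criterion: every classical unforced
solution with viscosity `ν > 0` on `ℝ³ × [0, T)`, Leray–Hopf from its rapidly decaying datum and
with `sup_{0 ≤ t < T} ‖u(t)‖_{L³} < ∞`, extends as a classical solution past `T`. The proof is
the marching argument of `hasSmoothExtensionPast_of_eLpNorm_three_bounded_of_tao2021'` (module
docstring) with `exp exp exp(A^C)` replaced by `max(F(A), 1)`: the Sobolev bounds established so
far put the solution in Tao's class on `[0, S]`, the hypothesis (at viscosity `ν`,
`subcubicESS_norm_le_of_velocity_bound`) bounds it by a constant `M` on `[T₁/4, S]` independent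
of `S`, the enstrophy inequality under this bound keeps `‖u(t)‖_{H¹}` controlled at the
restarting times, so Tao's local `H¹` solutions (`tao2011_smooth_local_existence_holds`) have a
uniform lifespan and, identified with `u` by weak–strong uniqueness
(`serrin_weak_strong_uniqueness_holds`), finitely many restarts pass `T` — contradicting
maximality. (Tao 2021, Thm. 1.2 ⇒ Thm. 1.1, arXiv:1908.04958 p. 2, run for an abstract `F`.) -/
theorem subcubicESS_uniformESSClosure_proof :
    Summit.NavierStokesRegularity.NavierStokesRegularity.Theses.SubcubicESS.UniformESSClosure := by
  unfold Summit.NavierStokesRegularity.NavierStokesRegularity.Theses.SubcubicESS.UniformESSClosure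
  rintro ⟨F, hTao⟩ ν T hν hT u p hsol hLH h₀ h₃
  by_contra hnot
  obtain ⟨c, hc, hloc⟩ := tao2011_smooth_local_existence_holds
  have hWS : serrin_weak_strong_uniqueness := serrin_weak_strong_uniqueness_holds
  have h0I : (0 : ℝ) ∈ Ico 0 T := ⟨le_rfl, hT⟩
  -- the critical bound `‖u(t)‖₃ ≤ N` on `[0, T)`
  set N : ℝ := (⨆ t ∈ Ico 0 T, eLpNorm (u t) 3 volume).toReal with hN
  have hNle : ∀ t ∈ Ico 0 T, eLpNorm (u t) 3 volume ≤ ENNReal.ofReal N := by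
    intro t ht
    rw [hN, ENNReal.ofReal_toReal h₃.ne]
    exact le_iSup₂ (f := fun t (_ : t ∈ Ico (0 : ℝ) T) => eLpNorm (u t) 3 volume) t ht
  -- energy bound `∫ |u(t)|² ≤ 2 E₀`
  set e₀ : ℝ := 2 * VectorCalculus.kineticEnergy (u 0) with he₀
  have he₀0 : 0 ≤ e₀ := mul_nonneg zero_le_two (kineticEnergy_nonneg _)
  have hener : ∀ t ∈ Icc 0 T, ∫⁻ x, ‖u t x‖ₑ ^ 2 ≤ ENNReal.ofReal e₀ := fun t ht =>
    hLH.lintegral_enorm_sq_le hν.le ht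
  /- ### A first smooth patch from the Schwartz datum -/
  have hHinf0 : ∀ n : ℕ, ∫⁻ x, ‖iteratedFDeriv ℝ n (u 0) x‖ₑ ^ 2 < ⊤ :=
    h₀.lintegral_enorm_iteratedFDeriv_sq_lt_top
  have hfrob_le3 : ∀ w : EuclideanSpace ℝ (Fin 3) → EuclideanSpace ℝ (Fin 3),
      ∫⁻ x, ENNReal.ofReal (frobeniusNormSq (fderiv ℝ w x)) ≤
        3 * ∫⁻ x, ‖iteratedFDeriv ℝ 1 w x‖ₑ ^ 2 := by
    intro w
    calc ∫⁻ x, ENNReal.ofReal (frobeniusNormSq (fderiv ℝ w x))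
        ≤ ∫⁻ x, 3 * ‖iteratedFDeriv ℝ 1 w x‖ₑ ^ 2 := lintegral_mono fun x => by
          rw [← ofReal_norm, norm_iteratedFDeriv_one, ofReal_norm]
          exact ofReal_frobeniusNormSq_le_three_mul_enorm_sq _
      _ = 3 * ∫⁻ x, ‖iteratedFDeriv ℝ 1 w x‖ₑ ^ 2 := lintegral_const_mul' _ _ (by simp)
  have hfrob0 : ∫⁻ x, ENNReal.ofReal (frobeniusNormSq (fderiv ℝ (u 0) x)) < ⊤ :=
    (hfrob_le3 (u 0)).trans_lt (ENNReal.mul_lt_top (by simp) (hHinf0 1))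
  set A₀ : ℝ := ((∫⁻ x, ‖u 0 x‖ₑ ^ 2) +
    ∫⁻ x, ENNReal.ofReal (frobeniusNormSq (fderiv ℝ (u 0) x))).toReal with hA₀
  have hA₀0 : 0 ≤ A₀ := ENNReal.toReal_nonneg
  have hA₀eq : (∫⁻ x, ‖u 0 x‖ₑ ^ 2) + ∫⁻ x, ENNReal.ofReal (frobeniusNormSq (fderiv ℝ (u 0) x))
      ≤ ENNReal.ofReal A₀ := by
    rw [hA₀, ENNReal.ofReal_toReal]
    exact ENNReal.add_ne_top.2 ⟨((hener 0 ⟨le_rfl, hT.le⟩).trans_lt ENNReal.ofReal_lt_top).ne,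
      hfrob0.ne⟩
  set T₁ : ℝ := min (T / 2) (c * ν ^ 3 / (A₀ ^ 2 + 1)) with hT₁
  have hT₁pos : 0 < T₁ := lt_min (by linarith) (by positivity)
  have hT₁T : T₁ < T := (min_le_left _ _).trans_lt (by linarith)
  have hT₁c : A₀ ^ 2 * T₁ ≤ c * ν ^ 3 := by
    calc A₀ ^ 2 * T₁ ≤ A₀ ^ 2 * (c * ν ^ 3 / (A₀ ^ 2 + 1)) :=
          mul_le_mul_of_nonneg_left (min_le_right _ _) (sq_nonneg _)
      _ = c * ν ^ 3 * (A₀ ^ 2 / (A₀ ^ 2 + 1)) := by ring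
      _ ≤ c * ν ^ 3 * 1 :=
          mul_le_mul_of_nonneg_left (by rw [div_le_one (by positivity)]; linarith) (by positivity)
      _ = c * ν ^ 3 := mul_one _
  obtain ⟨v₀, q₀, hv₀, hv₀0, hv₀b, -, hq₀b, hv₀c⟩ := hloc hν hT₁pos (hsol.contDiff_velocity h0I)
    (hsol.divFree 0 h0I) hHinf0 hA₀0 hA₀eq hT₁c
  -- `u = v₀` on `[0, T₁)` (restart at the good time `0`)
  have hLH0 : IsLerayHopfOn (T - 0) ν 0 (u 0) (fun t => u (t + 0)) := by
    simpa using hLH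
  have heq0 : ∀ t ∈ Ico 0 (min T₁ (T - 0)), u (t + 0) = v₀ t :=
    eq_restart_of_serrin hWS hν hT₁pos le_rfl hT hsol hLH0 hv₀ hv₀0 hv₀b hq₀b hv₀c
  have heq0' : ∀ t ∈ Ico 0 T₁, u t = v₀ t := fun t ht => by
    have := heq0 t ⟨ht.1, lt_min ht.2 (by linarith [ht.2])⟩
    simpa using this
  /- ### The constant `M` from the velocity bound, fixed once and for all -/
  set E : ℝ := max (F (max 2 (ν⁻¹ * N))) 1 with hEdef
  have hEpos : 0 < E := lt_of_lt_of_le one_pos (le_max_right _ _)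
  have hFE : F (max 2 (ν⁻¹ * N)) ≤ E := le_max_left _ _
  set M : ℝ := max (ν * E * (ν * (T₁ / 4)) ^ (-(1 / 2 : ℝ))) 1 with hM
  have hMpos : 0 < M := lt_of_lt_of_le one_pos (le_max_right _ _)
  -- Step 1 on `[0, S]`: Sobolev bounds on `[0, S]` give `|u| ≤ M` on `[T₁/4, S]`
  have hMb : ∀ S, T₁ / 4 < S → S < T → HasBoundedSobolevNormsOn (Icc 0 S) u →
      ∀ t ∈ Icc (T₁ / 4) S, ∀ x, ‖u t x‖ ≤ M := by
    intro S hS1 hST hHkS t ht x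
    have hS0 : 0 < S := lt_trans (by positivity) hS1
    have hsolS : IsClassicalNSSolutionOn (Icc 0 S) ν 0 u p :=
      hsol.mono (fun s hs => ⟨hs.1, hs.2.trans_lt hST⟩) (uniqueDiffOn_Icc hS0)
    have hNS : ∀ s ∈ Icc 0 S, eLpNorm (u s) 3 volume ≤ ENNReal.ofReal N := fun s hs =>
      hNle s ⟨hs.1, hs.2.trans_lt hST⟩
    have ht0 : 0 < t := lt_of_lt_of_le (by positivity) ht.1
    have h1 := subcubicESS_norm_le_of_velocity_bound hTao hν hS0 hsolS hHkS hNS t ⟨ht0, ht.2⟩ x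
    refine h1.trans (le_trans ?_ (le_max_left _ _))
    have hmono : (ν * t) ^ (-(1 / 2 : ℝ)) ≤ (ν * (T₁ / 4)) ^ (-(1 / 2 : ℝ)) :=
      Real.rpow_le_rpow_of_nonpos (by positivity) (mul_le_mul_of_nonneg_left ht.1 hν.le)
        (by norm_num)
    have hpow0 : 0 ≤ (ν * t) ^ (-(1 / 2 : ℝ)) := Real.rpow_nonneg (by positivity) _
    calc ν * F (max 2 (ν⁻¹ * N)) * (ν * t) ^ (-(1 / 2 : ℝ))
        ≤ ν * E * (ν * t) ^ (-(1 / 2 : ℝ)) :=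
          mul_le_mul_of_nonneg_right (mul_le_mul_of_nonneg_left hFE hν.le) hpow0
      _ ≤ ν * E * (ν * (T₁ / 4)) ^ (-(1 / 2 : ℝ)) :=
          mul_le_mul_of_nonneg_left hmono (by positivity)
  /- ### A good restarting time `t⋆ ∈ (T₁/2, T₁)` and the constants -/
  obtain ⟨tstar, htstar, hLHstar⟩ : ∃ s ∈ Ioo (T₁ / 2) T₁,
      IsLerayHopfOn (T - s) ν 0 (u s) (fun t => u (t + s)) := by
    have hae := hLH.ae_isLerayHopfOn_translate hsol hν.le
    have hsub : Ioo (T₁ / 2) T₁ ⊆ Ioo 0 T := fun s hs => ⟨by linarith [hs.1], hs.2.trans hT₁T⟩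
    have hae' : ∀ᵐ s ∂(volume.restrict (Ioo (T₁ / 2) T₁)),
        IsLerayHopfOn (T - s) ν 0 (u s) (fun t => u (t + s)) :=
      ae_restrict_of_ae_restrict_of_subset hsub hae
    exact exists_mem_Ioo_of_ae_restrict (by linarith) hae'
  have htstarT : tstar < T := htstar.2.trans hT₁T
  have htstar0 : 0 < tstar := by linarith [htstar.1]
  -- the slice `u t⋆` lies in the first patch
  have hslice_star : u tstar = v₀ tstar := heq0' tstar ⟨htstar0.le, htstar.2⟩
  have hstarI : tstar ∈ Icc 0 T₁ := ⟨htstar0.le, htstar.2.le⟩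
  have hg₀fin : ∫⁻ x, ENNReal.ofReal (frobeniusNormSq (fderiv ℝ (u tstar) x)) < ⊤ := by
    obtain ⟨C₁, hC₁⟩ := hv₀b 1
    rw [hslice_star]
    exact (hfrob_le3 (v₀ tstar)).trans_lt
      (ENNReal.mul_lt_top (by simp) ((hC₁ tstar hstarI).trans_lt ENNReal.coe_lt_top))
  set g₀ : ℝ := (∫⁻ x, ENNReal.ofReal (frobeniusNormSq (fderiv ℝ (u tstar) x))).toReal
    with hg₀
  have hg₀0 : 0 ≤ g₀ := ENNReal.toReal_nonneg
  set κ : ℝ := M ^ 2 / (2 * ν) with hκ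
  have hκ0 : 0 ≤ κ := by positivity
  set A : ℝ := e₀ + g₀ * Real.exp (κ * T) with hA
  have hApos : 0 ≤ A := by positivity
  set τ : ℝ := c * ν ^ 3 / ((A + 1) ^ 2) with hτ
  have hτpos : 0 < τ := by positivity
  have hτc : (A + 1) ^ 2 * τ ≤ c * ν ^ 3 := by
    rw [hτ, mul_div_cancel₀ _ (by positivity)]
  /- ### The invariant -/
  set Inv : ℝ → Prop := fun S => HasBoundedSobolevNormsOn (Icc 0 S) u ∧ ∀ t ∈ Icc tstar S,
    (∫⁻ x, ENNReal.ofReal (frobeniusNormSq (fderiv ℝ (u t) x)) ≤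
        ENNReal.ofReal (g₀ * Real.exp (κ * (t - tstar)))) with hInv
  -- base: `Inv t⋆`
  have hbase : Inv tstar := by
    refine ⟨fun n => ?_, fun t ht => ?_⟩
    · obtain ⟨C, hC⟩ := hv₀b n
      refine ⟨C, fun t ht => ?_⟩
      rw [heq0' t ⟨ht.1, ht.2.trans_lt htstar.2⟩]
      exact hC t ⟨ht.1, ht.2.trans htstar.2.le⟩
    · have hteq : t = tstar := le_antisymm ht.2 ht.1
      subst hteq
      rw [sub_self, mul_zero, Real.exp_zero, mul_one, hg₀, ENNReal.ofReal_toReal hg₀fin.ne]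
  /- ### The marching step -/
  have hstep : ∀ S, tstar ≤ S → S < T → Inv S → Inv (S + τ / 4) ∧ S + τ / 4 < T := by
    intro S hS hST hIS
    obtain ⟨hHkS, hEnS⟩ := hIS
    -- a good restarting time `t' ∈ (S - τ/4, S] ∩ [t⋆, S]`
    obtain ⟨t', ht'1, ht'2, ht'3, hLHt'⟩ : ∃ t', tstar ≤ t' ∧ t' ≤ S ∧ S - τ / 4 < t' ∧
        IsLerayHopfOn (T - t') ν 0 (u t') (fun t => u (t + t')) := by
      rcases eq_or_lt_of_le hS with h | h
      · exact ⟨tstar, le_rfl, h.le, by linarith, hLHstar⟩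
      · set a := max tstar (S - τ / 4) with ha
        have haS : a < S := max_lt h (by linarith)
        have hae := hLH.ae_isLerayHopfOn_translate hsol hν.le
        have hsub : Ioo a S ⊆ Ioo 0 T := fun s hs =>
          ⟨htstar0.trans_le ((le_max_left _ _).trans hs.1.le), hs.2.trans hST⟩
        have hae' : ∀ᵐ s ∂(volume.restrict (Ioo a S)),
            IsLerayHopfOn (T - s) ν 0 (u s) (fun t => u (t + s)) :=
          ae_restrict_of_ae_restrict_of_subset hsub hae
        obtain ⟨s, h2, h1⟩ := exists_mem_Ioo_of_ae_restrict haS hae'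
        exact ⟨s, (le_max_left _ _).trans h2.1.le, h2.2.le,
          (le_max_right _ _).trans_lt h2.1, h1⟩
    have ht'T : t' < T := ht'2.trans_lt hST
    have ht'0 : 0 < t' := htstar0.trans_le ht'1
    have ht'I : t' ∈ Icc tstar S := ⟨ht'1, ht'2⟩
    have hIt'1 := hEnS t' ht'I
    have hIt'2 : ∀ n : ℕ, ∫⁻ x, ‖iteratedFDeriv ℝ n (u t') x‖ₑ ^ 2 < ⊤ := fun n => by
      obtain ⟨C, hC⟩ := hHkS n
      exact (hC t' ⟨ht'0.le, ht'2⟩).trans_lt ENNReal.coe_lt_top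
    -- the datum `u t'` and its `H¹` bound
    have hexp_le : Real.exp (κ * (t' - tstar)) ≤ Real.exp (κ * T) :=
      Real.exp_le_exp.2 (mul_le_mul_of_nonneg_left (by linarith) hκ0)
    have hAeq : (∫⁻ x, ‖u t' x‖ₑ ^ 2) +
        ∫⁻ x, ENNReal.ofReal (frobeniusNormSq (fderiv ℝ (u t') x)) ≤ ENNReal.ofReal (A + 1) := by
      calc (∫⁻ x, ‖u t' x‖ₑ ^ 2) + ∫⁻ x, ENNReal.ofReal (frobeniusNormSq (fderiv ℝ (u t') x))
          ≤ ENNReal.ofReal e₀ + ENNReal.ofReal (g₀ * Real.exp (κ * (t' - tstar))) :=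
            add_le_add (hener t' ⟨ht'0.le, ht'T.le⟩) hIt'1
        _ ≤ ENNReal.ofReal e₀ + ENNReal.ofReal (g₀ * Real.exp (κ * T)) := by
            gcongr
        _ = ENNReal.ofReal A := by rw [hA, ENNReal.ofReal_add he₀0 (by positivity)]
        _ ≤ ENNReal.ofReal (A + 1) := ENNReal.ofReal_le_ofReal (by linarith)
    have ht'Ico : t' ∈ Ico 0 T := ⟨ht'0.le, ht'T⟩
    obtain ⟨v, q, hv, hv0, hvb, hvt, hqb, hvc⟩ := hloc hν hτpos (hsol.contDiff_velocity ht'Ico)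
      (hsol.divFree t' ht'Ico) hIt'2 (by positivity) hAeq hτc
    -- identification on `[0, min τ (T - t'))`
    have heq := eq_restart_of_serrin hWS hν hτpos ht'0.le ht'T hsol hLHt' hv hv0 hvb hqb hvc
    -- the alternative `t' + τ > T` would extend `u` past `T`
    have hτle : t' + τ ≤ T := by
      by_contra hlt
      push Not at hlt
      apply hnot
      refine HasSmoothExtensionPast.of_translate hsol ht'0 ht'T ⟨τ, by linarith, v, q,
        hv.mono Ico_subset_Icc_self (uniqueDiffOn_Ico 0 τ), fun t ht => ?_⟩
      exact (heq t ⟨ht.1, lt_min (by linarith [ht.2]) ht.2⟩).symm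
    have hmin : min τ (T - t') = τ := min_eq_left (by linarith)
    rw [hmin] at heq
    -- Sobolev bounds on `[0, t' + τ/2]`: those of `u` on `[0, S]` and those of `v` on `[0, τ]`
    have hHk2 : HasBoundedSobolevNormsOn (Icc 0 (t' + τ / 2)) u := by
      refine hHkS.union_Icc (fun n => ?_) ht'2
      obtain ⟨C, hC⟩ := hvb n
      refine ⟨C, fun t ht => ?_⟩
      have hs : t - t' ∈ Ico 0 τ := ⟨by linarith [ht.1], by linarith [ht.2]⟩
      have hut : u t = v (t - t') := by
        have := heq (t - t') hs
        rwa [sub_add_cancel] at this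
      rw [hut]
      exact hC _ ⟨hs.1, hs.2.le⟩
    -- the velocity bound on `[T₁/4, t' + τ/2]`, hence `|v| ≤ M` on `[0, τ/2] × ℝ³`
    have hS2T : t' + τ / 2 < T := by linarith
    have hS21 : T₁ / 4 < t' + τ / 2 := by linarith [htstar.1]
    have hMb2 := hMb (t' + τ / 2) hS21 hS2T hHk2
    have hvM : ∀ s ∈ Icc 0 (τ / 2), ∀ x, ‖v s x‖ ≤ M := by
      intro s hs x
      rw [← heq s ⟨hs.1, by linarith [hs.2]⟩]
      exact hMb2 (s + t') ⟨by linarith [htstar.1, hs.1], by linarith [hs.2]⟩ x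
    refine ⟨⟨hHk2.mono (Icc_subset_Icc le_rfl (by linarith)), ?_⟩, by linarith⟩
    -- the enstrophy invariant on `[t⋆, S + τ/4]`
    intro t ht
    rcases le_or_gt t t' with hle | hgt
    · exact hEnS t ⟨ht.1, hle.trans ht'2⟩
    · -- `t = t' + s` with `0 < s ≤ τ/2`
      have hs : t - t' ∈ Ioc 0 τ := ⟨by linarith, by linarith [ht.2]⟩
      have hs2 : t - t' ≤ τ / 2 := by linarith [ht.2]
      have hut : u t = v (t - t') := by
        have := heq (t - t') ⟨hs.1.le, by linarith⟩
        rwa [sub_add_cancel] at this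
      -- enstrophy: Grönwall for `v` on `[0, t - t']`, anchored at `v 0 = u t'`
      have hG := lintegral_frobeniusNormSq_fderiv_le_mul_exp hν hτpos hv hvb hvt hqb hMpos hs
        (fun s hs' x => hvM s ⟨hs'.1, hs'.2.trans hs2⟩ x)
      rw [hut]
      refine hG.trans ?_
      rw [hv0]
      calc ENNReal.ofReal (Real.exp (M ^ 2 * (t - t') / (2 * ν))) *
            ∫⁻ x, ENNReal.ofReal (frobeniusNormSq (fderiv ℝ (u t') x))
          ≤ ENNReal.ofReal (Real.exp (M ^ 2 * (t - t') / (2 * ν))) *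
            ENNReal.ofReal (g₀ * Real.exp (κ * (t' - tstar))) := by gcongr
        _ = ENNReal.ofReal (g₀ * Real.exp (κ * (t - tstar))) := by
            rw [← ENNReal.ofReal_mul (Real.exp_nonneg _)]
            congr 1
            rw [mul_left_comm, ← Real.exp_add, hκ]
            congr 1
            ring_nf
  /- ### Iterate -/
  have hiter : ∀ k : ℕ, Inv (tstar + k * (τ / 4)) ∧ tstar + k * (τ / 4) < T := by
    intro k
    induction k with
    | zero => simpa using ⟨hbase, htstarT⟩
    | succ k ih =>
      have h := hstep _ (by nlinarith [hτpos.le, (k.cast_nonneg : (0 : ℝ) ≤ k)]) ih.2 ih.1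
      have : tstar + (k : ℝ) * (τ / 4) + τ / 4 = tstar + ((k + 1 : ℕ) : ℝ) * (τ / 4) := by
        push_cast; ring
      rw [this] at h
      exact h
  obtain ⟨k, hk⟩ := exists_nat_gt ((T - tstar) / (τ / 4))
  have h1 := (hiter k).2
  have h2 : T - tstar < k * (τ / 4) := by
    rwa [div_lt_iff₀ (by positivity)] at hk
  linarith

end Summit.NavierStokesRegularity.NavierStokesRegularity.Theorems

end
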